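import Mathlib
import Summits.Ventures.PercRepro.TriangleCapTriangleFreeFourB
import Summits.Ventures.PercRepro.TriangleCapBipartiteFour

/-!
# PercRepro — FOUR BELOW THE DIAGONAL ON THE TRIANGLE-FREE CLASS, PART C: THE COUNT AT AN EDGE OF DEFICIT ONE AND
THE STABILITY `Σ_v d(v)² + 4 (k − 5) ≤ m k` (p3, gen 39; part 119)

For a triangle-free graph that is not bipartite spanning, with every degree `≥ 2`: either every ordered adjacent
pair has deficit `≥ 2` (`Σ deficit ≥ 4m`), or some edge `p q` has deficit exactly `1` and the structure of part A
(`V = A ⊔ B ⊔ {w}`, `A = N(q)`, `B = N(p)`, `A_w`, `B_w` the neighbours of `w`, `t = |A_w| < |A|`, `s = |B_w| < |B|`)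
pays, row by row over the neighbourhoods (`sum_deficit_eq_sum_rows`, the row lemmas of part B):
`w` pays `t |A ∖ A_w| + s |B ∖ B_w|`; `a ∈ A_w` pays `|A ∖ A_w| + s (d(a) − 1)`; `b ∈ B_w` symmetrically;
`a ∈ A ∖ A_w` pays `d(a) + (t − 1) |N(a) ∩ B_w|`; `b ∈ B ∖ B_w` pays `d(b) + (s − 1) |N(b) ∩ A_w|`; with the double
counts `e₁ = Σ_{A_w} (d − 1) = Σ_{B ∖ B_w} |N ∩ A_w| ≥ t`, `e₂` likewise, and `Σ d = 2m`:
`Σ deficit ≥ 2m + 2 t (|A| − t − 1) + 2 s (|B| − s − 1) + 2 (s − 1) e₁ + 2 (t − 1) e₂ ≥ 2m + 2 (k − 5)`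
(`deficit_one_arith`).  So **`sum_deficit_ge_of_deficit_one`** and **`triangle_free_stability_four`**:
triangle-free, `k ≥ 10`, `2m ≥ 6k − 26`, every degree `≥ 2`, not bipartite spanning with `≤ 3` missing cross pairs
⇒ `Σ_v d(v)² + 4 (k − 5) ≤ m k` (the bipartite case by `bipartite_stability_four`; `m + k − 5 ≥ 4 (k − 5)` as
`m ≥ 3k − 15`, and `2m ≥ 4 (k − 5)`).  Numbers (mining/p3/g39/tfnb2.c, every triangle-free non-bipartite graph
with `m ≥ 3k − 13`): the minimum of `mk − Σ d²` is `20` at `k = 9` (`m = 16`) and `24` at `k = 10` (`m = 19`,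
`K_{6,3}` minus an edge plus a vertex on its ends), against `4 (k − 5) = 16 / 20`.  Axioms: standard.
-/

namespace PercRepro

namespace TriangleCap

namespace C047

open Finset

variable {V : Type*} [Fintype V] [DecidableEq V]

/-- **THE COUNT AT AN EDGE OF DEFICIT ONE:** triangle-free, not bipartite spanning, every degree `≥ 2`, an edge
`p q` of deficit `1` ⇒ `Σ deficit ≥ 2m + 2 (k − 5)`. -/
theorem sum_deficit_ge_of_deficit_one (D : SimpleGraph V) [DecidableRel D.Adj] (hfree : D.CliqueFree 3)
    (hnb : ¬ ∃ A : Finset V, ∀ x y, D.Adj x y → (x ∈ A ↔ y ∉ A)) (hdeg : ∀ z, 2 ≤ deg D z) {p q : V}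
    (hpq : D.Adj p q) (h1 : deficit D (p, q) = 1) :
    2 * D.edgeFinset.card + 2 * (Fintype.card V - 5) ≤ ∑ p ∈ adjPairsAll D, deficit D p := by
  have htri := no_triangle_of_cliqueFree D hfree
  obtain ⟨w, hpw, hqw, huniq⟩ := exists_unique_far_of_deficit_one D h1
  obtain ⟨A, hA⟩ : ∃ A : Finset V, A = univ.filter (fun x => D.Adj q x) := ⟨_, rfl⟩
  obtain ⟨B, hB⟩ : ∃ B : Finset V, B = univ.filter (fun x => D.Adj p x) := ⟨_, rfl⟩
  have memA : ∀ x, x ∈ A ↔ D.Adj q x := fun x => by rw [hA, mem_filter]; simp only [mem_univ, true_and]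
  have memB : ∀ x, x ∈ B ↔ D.Adj p x := fun x => by rw [hB, mem_filter]; simp only [mem_univ, true_and]
  have hwA : w ∉ A := fun h => hqw ((memA w).mp h)
  have hwB : w ∉ B := fun h => hpw ((memB w).mp h)
  have hcov : ∀ x, x = w ∨ x ∈ A ∨ x ∈ B := by
    intro x
    by_cases hxw : x = w
    · exact Or.inl hxw
    · by_cases hpx : D.Adj p x
      · exact Or.inr (Or.inr ((memB x).mpr hpx))
      · by_cases hqx : D.Adj q x
        · exact Or.inr (Or.inl ((memA x).mpr hqx))
        · exact absurd (huniq x hpx hqx) hxw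
  have hAB : ∀ x, x ∈ A → x ∈ B → False := fun x hxA hxB =>
    htri q p x hpq.symm ((memA x).mp hxA) ((memB x).mp hxB)
  have hAind : ∀ x ∈ A, ∀ y ∈ A, ¬ D.Adj x y := fun x hx y hy hxy =>
    htri q x y ((memA x).mp hx) ((memA y).mp hy) hxy
  have hBind : ∀ x ∈ B, ∀ y ∈ B, ¬ D.Adj x y := fun x hx y hy hxy =>
    htri p x y ((memB x).mp hx) ((memB y).mp hy) hxy
  obtain ⟨Aw, hAw⟩ : ∃ Aw : Finset V, Aw = A.filter (fun x => D.Adj w x) := ⟨_, rfl⟩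
  obtain ⟨Bw, hBw⟩ : ∃ Bw : Finset V, Bw = B.filter (fun x => D.Adj w x) := ⟨_, rfl⟩
  obtain ⟨A', hA'⟩ : ∃ A' : Finset V, A' = A.filter (fun x => ¬ D.Adj w x) := ⟨_, rfl⟩
  obtain ⟨B', hB'⟩ : ∃ B' : Finset V, B' = B.filter (fun x => ¬ D.Adj w x) := ⟨_, rfl⟩
  have memAw : ∀ x, x ∈ Aw ↔ x ∈ A ∧ D.Adj w x := fun x => by rw [hAw, mem_filter]
  have memBw : ∀ x, x ∈ Bw ↔ x ∈ B ∧ D.Adj w x := fun x => by rw [hBw, mem_filter]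
  have memA' : ∀ x, x ∈ A' ↔ x ∈ A ∧ ¬ D.Adj w x := fun x => by rw [hA', mem_filter]
  have memB' : ∀ x, x ∈ B' ↔ x ∈ B ∧ ¬ D.Adj w x := fun x => by rw [hB', mem_filter]
  -- no edge between `Aw` and `Bw`
  have hnoAB : ∀ a ∈ Aw, ∀ b ∈ Bw, ¬ D.Adj a b := fun a ha b hb hab =>
    htri w a b ((memAw a).mp ha).2 ((memBw b).mp hb).2 hab
  -- `w` has a neighbour on each side, else the graph is bipartite
  have hAwne : Aw.Nonempty := by
    by_contra hne
    rw [not_nonempty_iff_eq_empty] at hne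
    have hnoA : ∀ x ∈ A, ¬ D.Adj w x := by
      intro x hx hwx
      have : x ∈ Aw := (memAw x).mpr ⟨hx, hwx⟩
      rw [hne] at this
      exact notMem_empty x this
    apply hnb
    refine ⟨B, fun x y hxy => ⟨fun hxB hyB => hBind x hxB y hyB hxy, fun hyB => ?_⟩⟩
    by_contra hxB
    rcases hcov x with hx | hx | hx
    · subst hx
      rcases hcov y with hy | hy | hy
      · exact D.irrefl (hy ▸ hxy)
      · exact hnoA y hy hxy
      · exact hyB hy
    · rcases hcov y with hy | hy | hy
      · subst hy
        exact hnoA x hx hxy.symm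
      · exact hAind x hx y hy hxy
      · exact hyB hy
    · exact hxB hx
  have hBwne : Bw.Nonempty := by
    by_contra hne
    rw [not_nonempty_iff_eq_empty] at hne
    have hnoB : ∀ x ∈ B, ¬ D.Adj w x := by
      intro x hx hwx
      have : x ∈ Bw := (memBw x).mpr ⟨hx, hwx⟩
      rw [hne] at this
      exact notMem_empty x this
    apply hnb
    refine ⟨A, fun x y hxy => ⟨fun hxA hyA => hAind x hxA y hyA hxy, fun hyA => ?_⟩⟩
    by_contra hxA
    rcases hcov x with hx | hx | hx
    · subst hx
      rcases hcov y with hy | hy | hy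
      · exact D.irrefl (hy ▸ hxy)
      · exact hyA hy
      · exact hnoB y hy hxy
    · exact hxA hx
    · rcases hcov y with hy | hy | hy
      · subst hy
        exact hnoB x hx hxy.symm
      · exact hyA hy
      · exact hBind x hx y hy hxy
  -- the neighbourhoods
  have hNw : univ.filter (fun y => D.Adj w y) = Aw ∪ Bw := by
    ext y
    rw [mem_filter, mem_union]
    constructor
    · intro h
      rcases hcov y with hy | hy | hy
      · subst hy; exact absurd h.2 D.irrefl
      · exact Or.inl ((memAw y).mpr ⟨hy, h.2⟩)
      · exact Or.inr ((memBw y).mpr ⟨hy, h.2⟩)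
    · intro h
      refine ⟨mem_univ y, ?_⟩
      rcases h with h | h
      · exact ((memAw y).mp h).2
      · exact ((memBw y).mp h).2
  have hNAw : ∀ x ∈ Aw, ∀ y, D.Adj x y → y = w ∨ y ∈ B' := by
    intro x hx y hxy
    obtain ⟨hxA, -⟩ := (memAw x).mp hx
    rcases hcov y with hy | hy | hy
    · exact Or.inl hy
    · exact absurd hxy (hAind x hxA y hy)
    · exact Or.inr ((memB' y).mpr ⟨hy, fun hwy => hnoAB x hx y ((memBw y).mpr ⟨hy, hwy⟩) hxy⟩)
  have hNBw : ∀ x ∈ Bw, ∀ y, D.Adj x y → y = w ∨ y ∈ A' := by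
    intro x hx y hxy
    obtain ⟨hxB, -⟩ := (memBw x).mp hx
    rcases hcov y with hy | hy | hy
    · exact Or.inl hy
    · exact Or.inr ((memA' y).mpr ⟨hy, fun hwy => hnoAB y ((memAw y).mpr ⟨hy, hwy⟩) x hx hxy.symm⟩)
    · exact absurd hxy (hBind x hxB y hy)
  have hNA' : ∀ x ∈ A', ∀ y, D.Adj x y → y ∈ B := by
    intro x hx y hxy
    obtain ⟨hxA, hwx⟩ := (memA' x).mp hx
    rcases hcov y with hy | hy | hy
    · subst hy; exact absurd hxy.symm hwx
    · exact absurd hxy (hAind x hxA y hy)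
    · exact hy
  have hNB' : ∀ x ∈ B', ∀ y, D.Adj x y → y ∈ A := by
    intro x hx y hxy
    obtain ⟨hxB, hwx⟩ := (memB' x).mp hx
    rcases hcov y with hy | hy | hy
    · subst hy; exact absurd hxy.symm hwx
    · exact hy
    · exact absurd hxy (hBind x hxB y hy)
  -- the cardinalities
  have hAsplit : Aw.card + A'.card = A.card := by rw [hAw, hA']; exact card_filter_add_card_filter_not _
  have hBsplit : Bw.card + B'.card = B.card := by rw [hBw, hB']; exact card_filter_add_card_filter_not _
  have huniv : (univ : Finset V) = {w} ∪ A ∪ B := by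
    ext x
    simp only [mem_univ, true_iff, mem_union, mem_singleton]
    rcases hcov x with h | h | h
    · exact Or.inl (Or.inl h)
    · exact Or.inl (Or.inr h)
    · exact Or.inr h
  have hdAB : Disjoint A B := by
    rw [disjoint_left]
    exact fun x hxA hxB => hAB x hxA hxB
  have hdwA : Disjoint ({w} : Finset V) A := by rw [disjoint_singleton_left]; exact hwA
  have hdwAB : Disjoint ({w} ∪ A) B := by
    rw [disjoint_union_left]
    exact ⟨by rw [disjoint_singleton_left]; exact hwB, hdAB⟩
  have hdAwBw : Disjoint Aw Bw := by
    rw [disjoint_left]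
    exact fun x hx hx' => hAB x ((memAw x).mp hx).1 ((memBw x).mp hx').1
  have hk : Fintype.card V = 1 + A.card + B.card := by
    rw [← card_univ, huniv, card_union_of_disjoint hdwAB, card_union_of_disjoint hdwA, card_singleton]
  have hsplit : ∀ g : V → ℕ, ∑ x, g x = g w + (∑ x ∈ A, g x + ∑ x ∈ B, g x) := by
    intro g
    rw [huniv, sum_union hdwAB, sum_union hdwA, sum_singleton, add_assoc]
  -- `Aw ≠ A` and `Bw ≠ B` from the degrees
  have hA'ne : A'.Nonempty := by
    by_contra hne
    rw [not_nonempty_iff_eq_empty] at hne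
    obtain ⟨b, hb⟩ := hBwne
    have hsub : univ.filter (fun y => D.Adj b y) ⊆ {w} := by
      intro y hy
      rw [mem_filter] at hy
      rcases hNBw b hb y hy.2 with h | h
      · rw [mem_singleton]; exact h
      · rw [hne] at h; exact absurd h (notMem_empty y)
    have := card_le_card hsub
    rw [card_singleton] at this
    have := hdeg b
    unfold deg at this
    omega
  have hB'ne : B'.Nonempty := by
    by_contra hne
    rw [not_nonempty_iff_eq_empty] at hne
    obtain ⟨a, ha⟩ := hAwne
    have hsub : univ.filter (fun y => D.Adj a y) ⊆ {w} := by
      intro y hy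
      rw [mem_filter] at hy
      rcases hNAw a ha y hy.2 with h | h
      · rw [mem_singleton]; exact h
      · rw [hne] at h; exact absurd h (notMem_empty y)
    have := card_le_card hsub
    rw [card_singleton] at this
    have := hdeg a
    unfold deg at this
    omega
  -- the pointwise deficits
  have hdef_wA : ∀ a ∈ Aw, A'.card ≤ deficit D (w, a) := fun a ha => card_le_deficit D A' (fun z hz =>
    ⟨((memA' z).mp hz).2, hAind a ((memAw a).mp ha).1 z ((memA' z).mp hz).1⟩)
  have hdef_wB : ∀ b ∈ Bw, B'.card ≤ deficit D (w, b) := fun b hb => card_le_deficit D B' (fun z hz =>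
    ⟨((memB' z).mp hz).2, hBind b ((memBw b).mp hb).1 z ((memB' z).mp hz).1⟩)
  have hdef_AwB' : ∀ a ∈ Aw, ∀ y ∈ B', Bw.card ≤ deficit D (a, y) := fun a ha y hy => card_le_deficit D Bw
    (fun z hz => ⟨hnoAB a ha z hz, hBind y ((memB' y).mp hy).1 z ((memBw z).mp hz).1⟩)
  have hdef_BwA' : ∀ b ∈ Bw, ∀ y ∈ A', Aw.card ≤ deficit D (b, y) := fun b hb y hy => card_le_deficit D Aw
    (fun z hz => ⟨fun h => hnoAB z hz b hb h.symm, hAind y ((memA' y).mp hy).1 z ((memAw z).mp hz).1⟩)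
  have hdef_A'B' : ∀ x ∈ A', ∀ y ∈ B', 1 ≤ deficit D (x, y) := by
    intro x hx y hy
    have := card_le_deficit D {w} (x := x) (y := y) (by
      intro z hz
      rw [mem_singleton] at hz
      subst hz
      exact ⟨fun h => ((memA' x).mp hx).2 h.symm, fun h => ((memB' y).mp hy).2 h.symm⟩)
    rwa [card_singleton] at this
  -- the rows
  have hroww := row_ge_union D w Aw Bw A'.card B'.card hNw hdAwBw hdef_wA hdef_wB
  have hrowAw : ∀ x ∈ Aw, A'.card + Bw.card * (deg D x - 1) ≤
      ∑ y ∈ univ.filter (fun y => D.Adj x y), deficit D (x, y) := by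
    intro x hx
    refine row_ge_special D ((memAw x).mp hx).2.symm A'.card Bw.card (by rw [deficit_symm]; exact hdef_wA x hx) ?_
    intro y hxy hyw
    rcases hNAw x hx y hxy with h | h
    · exact absurd h hyw
    · exact hdef_AwB' x hx y h
  have hrowBw : ∀ x ∈ Bw, B'.card + Aw.card * (deg D x - 1) ≤
      ∑ y ∈ univ.filter (fun y => D.Adj x y), deficit D (x, y) := by
    intro x hx
    refine row_ge_special D ((memBw x).mp hx).2.symm B'.card Aw.card (by rw [deficit_symm]; exact hdef_wB x hx) ?_
    intro y hxy hyw
    rcases hNBw x hx y hxy with h | h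
    · exact absurd h hyw
    · exact hdef_BwA' x hx y h
  have hrowA' : ∀ x ∈ A', deg D x + (Aw.card - 1) * (Bw.filter (fun y => D.Adj x y)).card ≤
      ∑ y ∈ univ.filter (fun y => D.Adj x y), deficit D (x, y) := by
    intro x hx
    apply row_ge_two_classes
    intro y hxy
    have hyB := hNA' x hx y hxy
    by_cases hyBw : y ∈ Bw
    · simp only [hyBw, if_true]
      have := hdef_BwA' y hyBw x hx
      rw [deficit_symm] at this
      have := hAwne.card_pos
      omega
    · simp only [hyBw, if_false, add_zero]
      exact hdef_A'B' x hx y ((memB' y).mpr ⟨hyB, fun h => hyBw ((memBw y).mpr ⟨hyB, h⟩)⟩)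
  have hrowB' : ∀ x ∈ B', deg D x + (Bw.card - 1) * (Aw.filter (fun y => D.Adj x y)).card ≤
      ∑ y ∈ univ.filter (fun y => D.Adj x y), deficit D (x, y) := by
    intro x hx
    apply row_ge_two_classes
    intro y hxy
    have hyA := hNB' x hx y hxy
    by_cases hyAw : y ∈ Aw
    · simp only [hyAw, if_true]
      have := hdef_AwB' y hyAw x hx
      rw [deficit_symm] at this
      have := hBwne.card_pos
      omega
    · simp only [hyAw, if_false, add_zero]
      have := hdef_A'B' y ((memA' y).mpr ⟨hyA, fun h => hyAw ((memAw y).mpr ⟨hyA, h⟩)⟩) x hx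
      rwa [deficit_symm] at this
  -- sum the rows
  rw [sum_deficit_eq_sum_rows, hsplit, ← sum_filter_add_sum_filter_not A (fun x => D.Adj w x),
    ← sum_filter_add_sum_filter_not B (fun x => D.Adj w x), ← hAw, ← hA', ← hBw, ← hB']
  have hsAw := sum_le_sum hrowAw
  have hsBw := sum_le_sum hrowBw
  have hsA' := sum_le_sum hrowA'
  have hsB' := sum_le_sum hrowB'
  rw [sum_add_distrib, sum_const, smul_eq_mul, ← mul_sum] at hsAw hsBw
  rw [sum_add_distrib, ← mul_sum] at hsA' hsB'
  -- the double counts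
  have he₁ := sum_card_filter_eq_sum_pred D Aw B' w (fun h => hwB ((memB' w).mp h).1)
    (fun x hx => ((memAw x).mp hx).2.symm) hNAw
  have he₂ := sum_card_filter_eq_sum_pred D Bw A' w (fun h => hwA ((memA' w).mp h).1)
    (fun x hx => ((memBw x).mp hx).2.symm) hNBw
  rw [he₁] at hsB'
  rw [he₂] at hsA'
  -- the degree sums
  have hdegsum : ∑ v, deg D v = 2 * D.edgeFinset.card := sum_deg_eq D
  rw [hsplit, ← sum_filter_add_sum_filter_not A (fun x => D.Adj w x),
    ← sum_filter_add_sum_filter_not B (fun x => D.Adj w x), ← hAw, ← hA', ← hBw, ← hB'] at hdegsum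
  have hdegw : deg D w = Aw.card + Bw.card := by
    unfold deg
    rw [hNw, card_union_of_disjoint hdAwBw]
  have hdeg1 : ∀ z, 1 ≤ deg D z := fun z => by have := hdeg z; omega
  have hsumAw := sum_deg_eq_sum_pred_add D Aw hdeg1
  have hsumBw := sum_deg_eq_sum_pred_add D Bw hdeg1
  have he₁ge := card_le_sum_pred D Aw hdeg
  have he₂ge := card_le_sum_pred D Bw hdeg
  -- assemble
  have ht1 : 1 ≤ Aw.card := hAwne.card_pos
  have hs1 : 1 ≤ Bw.card := hBwne.card_pos
  have ha1 : 1 ≤ A'.card := hA'ne.card_pos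
  have hb1 : 1 ≤ B'.card := hB'ne.card_pos
  have harith := deficit_one_arith Aw.card Bw.card A.card B.card (∑ x ∈ Aw, (deg D x - 1))
    (∑ x ∈ Bw, (deg D x - 1)) ht1 (by omega) hs1 (by omega) he₁ge he₂ge
  have e1 : A.card - Aw.card - 1 = A'.card - 1 := by omega
  have e2 : B.card - Bw.card - 1 = B'.card - 1 := by omega
  rw [e1, e2] at harith
  rw [hk]
  have e3 : 1 + A.card + B.card - 5 = A.card + B.card - 4 := by omega
  rw [e3]
  set t := Aw.card with htdef
  set s := Bw.card with hsdef
  set a' := A'.card with ha'def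
  set b' := B'.card with hb'def
  set e₁ := ∑ x ∈ Aw, (deg D x - 1) with he₁def
  set e₂ := ∑ x ∈ Bw, (deg D x - 1) with he₂def
  clear_value t s a' b' e₁ e₂
  have hta : t * a' = t * (a' - 1) + t := by
    obtain ⟨a'', rfl⟩ : ∃ a'', a' = a'' + 1 := ⟨a' - 1, by omega⟩
    simp only [Nat.add_sub_cancel]
    ring
  have hsb : s * b' = s * (b' - 1) + s := by
    obtain ⟨b'', rfl⟩ : ∃ b'', b' = b'' + 1 := ⟨b' - 1, by omega⟩
    simp only [Nat.add_sub_cancel]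
    ring
  have hst : (s - 1) * e₁ + e₁ = s * e₁ := by
    obtain ⟨s', rfl⟩ : ∃ s', s = s' + 1 := ⟨s - 1, by omega⟩
    simp only [Nat.add_sub_cancel]
    ring
  have hts : (t - 1) * e₂ + e₂ = t * e₂ := by
    obtain ⟨t', rfl⟩ : ∃ t', t = t' + 1 := ⟨t - 1, by omega⟩
    simp only [Nat.add_sub_cancel]
    ring
  linarith [hroww, hsAw, hsBw, hsA', hsB', hdegsum, hdegw, hsumAw, hsumBw, harith, hta, hsb, hst, hts]

/-- **FOUR BELOW THE DIAGONAL ON THE TRIANGLE-FREE CLASS:** triangle-free, `k ≥ 10`, `2m ≥ 6k − 26`, every degree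
`≥ 2`, not bipartite spanning with at most three missing cross pairs ⇒ `Σ_v d(v)² + 4 (k − 5) ≤ m k`. -/
theorem triangle_free_stability_four (D : SimpleGraph V) [DecidableRel D.Adj] (hfree : D.CliqueFree 3)
    (hk : 10 ≤ Fintype.card V) (hm : 6 * Fintype.card V ≤ 2 * D.edgeFinset.card + 26) (hdeg : ∀ z, 2 ≤ deg D z)
    (hnot : ¬ ∃ A : Finset V, (∀ x y, D.Adj x y → (x ∈ A ↔ y ∉ A)) ∧ (missing D A Aᶜ).card ≤ 3) :
    ∑ v, deg D v * deg D v + 4 * (Fintype.card V - 5) ≤ D.edgeFinset.card * Fintype.card V := by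
  by_cases hbip : ∃ A : Finset V, ∀ x y, D.Adj x y → (x ∈ A ↔ y ∉ A)
  · obtain ⟨A, hA⟩ := hbip
    have hN : 4 ≤ (missing D A Aᶜ).card := by
      by_contra h
      exact hnot ⟨A, hA, by omega⟩
    exact bipartite_stability_four D A hA hN hdeg
  have hid := two_mul_sum_deg_sq_add_sum_deficit D
  rw [card_triangles3_eq_zero_of_cliqueFree D hfree, add_zero] at hid
  obtain ⟨k', hk'⟩ : ∃ k', Fintype.card V = k' + 10 := ⟨Fintype.card V - 10, by omega⟩
  by_cases hall : ∀ p ∈ adjPairsAll D, 2 ≤ deficit D p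
  · have h2 : ∑ p ∈ adjPairsAll D, 2 ≤ ∑ p ∈ adjPairsAll D, deficit D p := sum_le_sum hall
    rw [sum_const, smul_eq_mul, card_adjPairsAll] at h2
    rw [hk'] at hid hm ⊢
    have e : k' + 10 - 5 = k' + 5 := by omega
    rw [e]
    nlinarith
  · push Not at hall
    obtain ⟨⟨x, y⟩, hp, hlt⟩ := hall
    rw [mem_adjPairsAll] at hp
    simp only at hp
    have h1 : deficit D (x, y) = 1 := by
      have := deficit_pos_of_not_bipartite D hfree hbip x y
      omega
    have hcount := sum_deficit_ge_of_deficit_one D hfree hbip hdeg hp h1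
    rw [hk'] at hid hm hcount ⊢
    have e : k' + 10 - 5 = k' + 5 := by omega
    rw [e] at hcount ⊢
    nlinarith

end C047

end TriangleCap

end PercRepro
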